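import Summits.HodgeConjecture.HodgeConjecture.Theorems.Ring2TransportWeilTypeGeneralCMFieldClosed
import HarnessLib

/-!
# Ring-2 transport, gen 13 (ν): WEIL-DIVISORIAL CM anchors — `HC_CM` is nominal as an anchor over EVERY CM field

HONEST FRAMING (page 1, verbatim for the cell):
research route conditional on HC_CM; not a corollary; Q11.4-sentence-2 already refuted in dim ≥ 3. `HC_CM` := the binder `Theses.RankFourFaces.CMAbelianHodge`
(stmt-HodgeConjecture-3052), ALWAYS a hypothesis where it occurs, never a fact; in THIS file it occurs only as a
CONCLUSION (§3). Markman's preprints [M] arXiv:2502.03415, [S] arXiv:2509.23403, [C] arXiv:2509.23079 and Perry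
[P] arXiv:2604.00511 are UNREFEREED and are inputs of NO theorem below; Deligne's endnote (fact #24,
`Deligne1982_hodgeRing_weilTypeCM_of_hodgeGroupSU`) is UNREFEREED ×2 and enters §2 only as an explicit binder `h24`.

## What this file corrects (the gen-13 structural result of the transport seat)

Gens 2–12 measured where `HC_CM` is LOAD-BEARING AS AN ANCHOR on the CM-field rows (R3 =
`WeilTypeLadder.WeilClassesCMField`, R3-local, R3-germ, T6-CM) by the notion ANCHOR-GOOD `K` (gen 2, file
`Ring2TransportDivisorGeneratedAnchors`): some CM type of `K` descends to a nondegenerate primitive type, so that the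
diagonal CM member `B_Φ^{2m}` of every `(K, m, δ)`-Weil component has its WHOLE Hodge ring generated by divisors
(Hazama) and the leaf `DivisorGeneratedCMPointedWeilFamiliesCMField` (Sup_div) holds in print; the censuses M(24),
M(28), M(30) found no non-anchor-good CM field of degree `≤ 30`.

That hypothesis is SUFFICIENT BUT NOT NECESSARY. The rows consume the algebraicity of ONE class on the CM fibre —
the restriction `W|_{𝒳_{s₀}}` of the Weil section, which lies in the fibre's own `W_K ⊗ ℂ` — and `W_K` of the
diagonal member is divisorial for EVERY CM type `Φ`, degenerate or not:

**Lemma N** (cell-internal and elementary; first recorded by the habitat seat, gen 18 (`HPLUS-CM-A.md`, RING2-MAP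
HA92–HA97), re-derived independently by this seat). `K` a CM field, `[K:ℚ] = e`, `Φ` ANY CM type of `K`, `B_Φ`
of type `(K, Φ)`, `B_Φ̄` of the conjugate type, `C := B_Φ × B_Φ̄` with the diagonal `K`-action: `K`-rank `2`,
multiplicities `(n_σ, n_σ̄) = (1,1)` at every `σ`.
(N1) `W_K(C) = ⋀²_K H¹(C, ℚ) ⊆ NS(C)_ℚ`: by Moonen–Zarhin's criterion (i) every class of `W_K(C) ⊗ ℂ` is of type
`(1,1)`; `W_K(C) ⊗ ℂ` is spanned by rational classes; Lefschetz `(1,1)`. §0 below is this step KERNEL-CHECKED on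
the tree's carriers for every `K`-rank-2 pair with balanced multiplicities (`weilClassesField_two_le_divisorClassesSpan`).
(N2) for `m ≥ 1`, `W_K(Cᵐ) ⊗ ℂ = ⊕_σ ⋀^{2m}(⊕ᵢ pᵢ^* V_σ(C)) = ⊕_σ ⊗ᵢ pᵢ^* ⋀² V_σ(C)` (the only multi-index of
total degree `2m` with entries `≤ 2 = dim V_σ(C)` is `(2,…,2)`), so every class of `W_K(Cᵐ) ⊗ ℂ` is a sum of
products `p₁^*d₁ ∪ ⋯ ∪ p_m^*d_m`, `dᵢ ∈ W_K(C) ⊗ ℂ ⊆ NS(C) ⊗ ℂ`: `W_K(Cᵐ) ⊗ ℂ ⊆ Dᵐ(Cᵐ) ⊗ ℂ`. (Print; product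
carriers with a `K`-action are not in the tree — this is the print content of the last clause of the §1 leaf.)
(N3) `Cᵐ ≅ B_Φ^{2m}` (as a variety) with a twisted product polarisation lies, up to `K`-isogeny, on EVERY
connected component of EVERY `(K, m, δ)`-Weil moduli variety: a `K/K⁺`-hermitian space of signature `(m,m)` at
every real place is isometric to a diagonal one `⟨f₁,…,f_m,g₁,…,g_m⟩` with `fᵢ` `Φ`-positive and `gⱼ`
`Φ̄`-positive, every admissible discriminant class occurring (Landherr), and every connected component contains a
Hecke translate of a given special point (Deligne; Milne); `W_K`, `NS_ℚ`, `Dᵐ` are `K`-isogeny invariants.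
CONSEQUENCE: the moduli argument supplies, on every component over EVERY CM field `K`, a CM point at which THE WEIL
CLASSES are divisorial — no descent to a nondegenerate type, no census. `HC_CM` is NOMINAL as an anchor on the rows
R3 / R3-local / R3-germ / T6-CM(-local, -germ) in every CM degree; anchor-goodness and the censuses M(24)–M(30)
remain true statements about FULL Hodge rings `B•(B_Φᴺ)` (Hazama's situation; they still decide where the CM fibre
satisfies the full Hodge conjecture by divisors) but no longer decide load-bearingness of `HC_CM`. What stays
load-bearing on the transport line is exactly the VARIATIONAL input (R3var, or its local / semiregular weakenings)
and the existence of the families (typed leaves, OPEN as formal statements of the tree).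

## Contents
* §0 `weilClassesField_two_le_divisorClassesSpan` (+ `…_le_algebraicClasses`, `weilClassesCMField_rank_two`):
  Lemma N (N1) in the kernel — for carriers `(C, φ, P, e)` with `P` monic irreducible, `P(φ) = 0`,
  `e · 2 = 2 dim C` and balanced multiplicities, `W_K ⊗ ℂ ⊆ D¹ ⊗ ℂ`. Fact-free: Moonen–Zarhin's criterion and the
  rational spanning of `W_K ⊗ ℂ` are tree THEOREMS (`MoonenZarhin1998_weilClasses_hodgeCriterion_holds`,
  `weilClassesField_eq_span_isRationalClass`).
* §1 the leaf `WeilDivisorialCMPointedWeilFamiliesCMField` (Sup_Wdiv): VERBATIM gen 1's `CMPointedWeilFamiliesCMField`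
  with the CM chart `e₀ : A₀.X ≅ 𝒳_{s₀}` explicit and ONE more conjunct — the restricted class, read in `A₀`, lies in
  `Dᵐ(A₀) ⊗ ℂ`. Implied by gen 2's Sup_div (`weilDivisorialCMPointed_of_divisorGeneratedCMPointed`); implies gen 1's
  Sup (`cmPointedWeilFamiliesCMField_of_weilDivisorialCMPointed`) and — with NO `HC_CM` — R3anc
  (`anchoredWeilFamiliesCMField_of_weilDivisorialCMPointed`).
* §2 rows without `HC_CM`: R3 (`HC_WeilClassesCMField_of_weilDivisorialCMPointed`), R3-local (`…_local`), R3-germ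
  (`…_of_semiregularChernLift`), T6-CM closed (`HC_GeneralWeilTypeCMField_of_weilDivisorialCMPointed_closed`, `h24`).
* §3 `HC_CM` as an OUTPUT of the transport line: André 1992 + the two `HC_CM`-free top rungs
  (`HC_CM_of_andre_of_weilDivisorialCMPointed_of_variational`), sharpening gen 2's §5 caveat — the CM-field anchor
  leaf used is now the one print supplies for every `K`.
* §4 audit conjunction `weilDivisorialAnchors_position`.

Nothing here decides R3, T6-CM, `HC_AV` or `HC_CM`: every theorem whose conclusion is a rung has an OPEN typed leaf
among its hypotheses. No Literature file is touched; no internally minted statement is cited as a fact.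
-/

set_option linter.dupNamespace false

noncomputable section

open CategoryTheory

namespace Summit.HodgeConjecture.HodgeConjecture.Ring2Transport

open Literature.AlgebraicGeometry Literature.AlgebraicGeometry.Motives
open Literature.AlgebraicGeometry.HodgeTheory
open Literature.AlgebraicGeometry.Deligne1982
open Literature.AlgebraicTopology.SingularHomology
open Literature.AlgebraicGeometry.Milne1999 (IsOfCMType)
open Literature.Barriers.HodgeConjecture (divisorClassesSpan divisorMonomials mem_divisorMonomials_one)
open Summit.HodgeConjecture.HodgeConjecture.WeilTypeLadder
open Summit.HodgeConjecture.HodgeConjecture.Theses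

/-! ### §0 Lemma N (N1) in the kernel: on a `K`-rank-2 pair with balanced multiplicities, `W_K ⊗ ℂ ⊆ NS ⊗ ℂ` -/

/-- **Weil classes in `K`-rank 2 are divisor classes — no `HC_CM`, no named fact.** For a complex abelian variety
`C`, `φ : C ⟶ C` with `P(φ) = 0` for a monic `P ∈ ℤ[T]` irreducible over `ℚ` of degree `e` with `e · 2 = 2 dim C`
(`K = ℚ(φ)` of degree `e`, `H¹(C, ℚ)` of `K`-rank `2`), and balanced multiplicities `n_ρ = n_ρ̄` at every complex
root (signature `(1,1)` at every `σ`): `W_K ⊗ ℂ = weilClassesField C φ P 2 ⊆ D¹(C) ⊗ ℂ` — the complex span of the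
rational `(1,1)` classes. Proof: `W_K ⊗ ℂ` is the span of its rational classes
(`weilClassesField_eq_span_isRationalClass`, Moonen–Zarhin §1 / Deligne (4.4)); each is of type `(1,1)` by
Moonen–Zarhin's criterion (i), a tree theorem (`MoonenZarhin1998_weilClasses_hodgeCriterion_holds`); a rational
`(1,1)` class is a divisor monomial of degree `1` (`mem_divisorMonomials_one`). This is step (N1) of Lemma N of the
module docstring, for EVERY such pair — in particular for `C = B_Φ × B_Φ̄` with `Φ` an arbitrary (possibly
degenerate) CM type. [cite: MoonenZarhin1998WeilClasses, §1 (Criterion; W_F ⊗ ℂ = ⊕_σ ⋀^r V_{ℂ,σ})]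
[cite: Deligne1982HodgeCycles, §4 (4.4) and Prop. 4.4] [cite: vanGeemen1994HodgeAV, §2.4] -/
theorem weilClassesField_two_le_divisorClassesSpan {C : Motives.AbelianVariety ℂ} {φ : C ⟶ C}
    {P : Polynomial ℤ} {e : ℕ} (hP : P.Monic) (hPe : P.natDegree = e)
    (hPirr : Irreducible (P.map (Int.castRingHom ℚ)))
    (hφ : Polynomial.eval₂ (Int.castRingHom (CategoryTheory.End C)) (φ : CategoryTheory.End C) P = 0)
    (her : e * (2 * 1) = 2 * C.dim)
    (hbal : ∀ ρ : ℂ, Polynomial.eval₂ (Int.castRingHom ℂ) ρ P = 0 →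
      eigenMultiplicity C φ ρ = eigenMultiplicity C φ (starRingEnd ℂ ρ)) :
    weilClassesField C φ P (2 * 1) ≤ divisorClassesSpan C.X C.dim 1 := by
  rw [weilClassesField_eq_span_isRationalClass hPirr hφ (2 * 1)]
  refine Submodule.span_le.2 ?_
  rintro c ⟨hcQ, hcW⟩
  have hcH : IsOfHodgeType C.dim C.X 2 1 1 c := by
    simpa using (MoonenZarhin1998_weilClasses_hodgeCriterion_holds C φ P e (2 * 1) hP hPe hPirr hφ her).1 hbal c hcW
  have h1 : cupProduct (show 2 * 0 + 2 = 2 * (0 + 1) by ring) (singularCohomology.one ℂ (ComplexPoints C.X)) c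
      ∈ divisorMonomials C.X C.dim (0 + 1) := mem_divisorMonomials_one hcQ hcH
  have h2 : cupProduct (show 2 * 0 + 2 = 2 * (0 + 1) by ring) (singularCohomology.one ℂ (ComplexPoints C.X)) c = c :=
    one_cupProduct c
  rw [h2] at h1
  exact Submodule.subset_span h1

/-- Hence `W_K ⊗ ℂ ⊆ N¹ H²` in `K`-rank 2 with balanced multiplicities (divisor classes are algebraic on an abelian
variety, `divisorClassesSpan_le_algebraicClasses_dim`). [cite: MoonenZarhin1998WeilClasses, §1 (Criterion)]
[cite: vanGeemen1994HodgeAV, §2.4] -/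
theorem weilClassesField_two_le_algebraicClasses {C : Motives.AbelianVariety ℂ} {φ : C ⟶ C}
    {P : Polynomial ℤ} {e : ℕ} (hP : P.Monic) (hPe : P.natDegree = e)
    (hPirr : Irreducible (P.map (Int.castRingHom ℚ)))
    (hφ : Polynomial.eval₂ (Int.castRingHom (CategoryTheory.End C)) (φ : CategoryTheory.End C) P = 0)
    (her : e * (2 * 1) = 2 * C.dim)
    (hbal : ∀ ρ : ℂ, Polynomial.eval₂ (Int.castRingHom ℂ) ρ P = 0 →
      eigenMultiplicity C φ ρ = eigenMultiplicity C φ (starRingEnd ℂ ρ)) :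
    weilClassesField C φ P (2 * 1) ≤ algebraicClasses C.X 1 :=
  (weilClassesField_two_le_divisorClassesSpan hP hPe hPirr hφ her hbal).trans
    (divisorClassesSpan_le_algebraicClasses_dim C 1)

/-- **R3 in `K`-rank 2 is a theorem** (the first rung of `WeilClassesCMField` in the variable `m`): at `m = 1` a
rational `(1,1)` class is algebraic by Lefschetz `(1,1)` alone — recorded so that the ladder's floor over a CM field
of ANY degree is a kernel fact, not a leaf. [cite: vanGeemen1994HodgeAV, §2.4] [cite: MoonenZarhin1998WeilClasses, §1] -/
theorem weilClassesCMField_rank_two (A : Motives.AbelianVariety ℂ) (φ : A ⟶ A) (P : Polynomial ℤ)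
    (c : complexBetti A.X (2 * 1)) (_hc : c ∈ weilClassesField A φ P (2 * 1)) (hcQ : IsRationalClass c)
    (hcH : IsOfHodgeType A.dim A.X (2 * 1) 1 1 c) : c ∈ algebraicClasses A.X 1 :=
  lefschetzOneOne_rational_holds (Motives.AbelianVariety.isSmoothProjective_holds (A := A)) c hcQ hcH

/-! ### §1 The WEIL-DIVISORIAL CM-pointed family leaf (typed missing input) -/

/-- **Weil-divisorial CM-pointed Weil families, CM field `K = ℚ[T]/(P)` of degree `e > 2` (typed missing input;
Summit-side leaf, OURS, NOT a Literature fact, NOT a case of HC).** VERBATIM gen 1's `CMPointedWeilFamiliesCMField`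
(a smooth projective `K`-Weil family over a smooth irreducible quasi-projective base through `(A, c)` with a global
class `W` fibrewise rational of type `(m,m)` and confined to `W_K ⊗ ℂ` through charts, a fibre `𝒳_{s₁} ≅ A.X` on
which `W` reads `c`, and a CM-presented fibre `𝒳_{s₀} ≅ A₀.X`, `A₀` of CM type) with the CM chart explicit and ONE
MORE conjunct: the restricted class `W|_{𝒳_{s₀}}`, read in `A₀`, lies in `Dᵐ(A₀) ⊗ ℂ` (`divisorClassesSpan`).
WEAKER than gen 2's `DivisorGeneratedCMPointedWeilFamiliesCMField` (all rational `(m,m)` classes of `A₀` divisorial —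
Hazama's situation, anchor-good `K`): `weilDivisorialCMPointed_of_divisorGeneratedCMPointed`. IN PRINT (Lemma N of the
module docstring, (N1)–(N3): Mumford's families of Hodge type, Deligne's Weil-type families, Landherr's
classification, CM points on every component, and the divisoriality of `W_K` of the diagonal member
`B_Φᵐ × B_Φ̄ᵐ` for EVERY CM type `Φ`) this leaf is EXACTLY as available as gen 1's, for EVERY CM field `K` — no
anchor-goodness, no census; (N1) is the kernel theorem `weilClassesField_two_le_divisorClassesSpan`, (N2) needs
product carriers with a `K`-action (not in the tree), (N3) needs the moduli spaces (not in the tree). OPEN as a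
formal statement of the tree (families, charts and `W` must be produced). Implies gen 1's leaf and, WITHOUT `HC_CM`,
R3anc (`anchoredWeilFamiliesCMField_of_weilDivisorialCMPointed`).
[cite: Deligne1982HodgeCycles, §4 (4.4), Prop. 4.4, proof of Thm. 4.8 (a)–(c) and §5]
[cite: MoonenZarhin1998WeilClasses, §1 (Criterion)] [cite: Landherr1936HermitianForms, Hauptsatz]
[cite: Mumford1969NoteShimura, §3] [cite: GaoUllmo2025, §1.2 and Def. 4.1] [cite: vanGeemen1994HodgeAV, §2.4]
[status: open] -/
@[conjecture] def WeilDivisorialCMPointedWeilFamiliesCMField : Prop :=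
  ∀ (A : Motives.AbelianVariety ℂ) (φ : A ⟶ A) (P : Polynomial ℤ) (e m : ℕ),
    P.Monic → P.natDegree = e → 2 < e → Irreducible (P.map (Int.castRingHom ℚ)) →
    Polynomial.eval₂ (Int.castRingHom (CategoryTheory.End A)) (φ : CategoryTheory.End A) P = 0 →
    e * (2 * m) = 2 * A.dim →
    (∀ ρ : ℂ, Polynomial.eval₂ (Int.castRingHom ℂ) ρ P = 0 → starRingEnd ℂ ρ ≠ ρ) →
    (∃ Q : Polynomial ℚ, ∀ ρ : ℂ, Polynomial.eval₂ (Int.castRingHom ℂ) ρ P = 0 →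
        Polynomial.eval₂ (algebraMap ℚ ℂ) ρ Q = starRingEnd ℂ ρ) →
      ∀ c ∈ weilClassesField A φ P (2 * m), IsRationalClass c →
        IsOfHodgeType A.dim A.X (2 * m) m m c → c ≠ 0 →
        ∃ (𝒳 S : Motives.SchemeOver ℂ) (f : 𝒳 ⟶ S) (s₁ s₀ : Motives.ComplexPoints S)
            (ι : A.X ≅ Motives.fiberOver f s₁) (W : complexBetti 𝒳 (2 * m)),
          Motives.IsSmoothProjectiveFamily f (e * m) ∧ IsQuasiProjectiveOver 𝒳 ∧ IsQuasiProjectiveOver S ∧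
          IrreducibleSpace S.left ∧ AlgebraicGeometry.Smooth S.hom ∧
          (∀ s : Motives.ComplexPoints S,
            IsRationalClass (complexBetti.map (Motives.fiberι f s) (2 * m) W) ∧
              IsOfHodgeType (e * m) (Motives.fiberOver f s) (2 * m) m m
                (complexBetti.map (Motives.fiberι f s) (2 * m) W)) ∧
          (∀ s : Motives.ComplexPoints S, ∃ (A' : Motives.AbelianVariety ℂ) (φ' : A' ⟶ A')
              (e' : A'.X ≅ Motives.fiberOver f s),
            Polynomial.eval₂ (Int.castRingHom (CategoryTheory.End A')) (φ' : CategoryTheory.End A') P = 0 ∧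
              e * (2 * m) = 2 * A'.dim ∧
              complexBetti.map e'.hom (2 * m) (complexBetti.map (Motives.fiberι f s) (2 * m) W) ∈
                weilClassesField A' φ' P (2 * m)) ∧
          complexBetti.map ι.hom (2 * m) (complexBetti.map (Motives.fiberι f s₁) (2 * m) W) = c ∧
          ∃ (A₀ : Motives.AbelianVariety ℂ) (e₀ : A₀.X ≅ Motives.fiberOver f s₀),
            A₀.dim = e * m ∧ IsOfCMType A₀ ∧
              complexBetti.map e₀.hom (2 * m) (complexBetti.map (Motives.fiberι f s₀) (2 * m) W) ∈
                divisorClassesSpan A₀.X A₀.dim m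

/-- Gen 2's divisor-generated leaf (anchor-good `K`, Hazama) implies the Weil-divisorial leaf: the restricted class is
rational of type `(m,m)`, hence divisorial on a divisor-generated CM fibre. [cite: Gordon1997, Thm. 6.4 (Hazama)]
[cite: vanGeemen1994HodgeAV, §2.4] -/
theorem weilDivisorialCMPointed_of_divisorGeneratedCMPointed
    (hP : DivisorGeneratedCMPointedWeilFamiliesCMField) : WeilDivisorialCMPointedWeilFamiliesCMField := by
  intro A φ P e m hPm hPe he hirr hφ hdim hnr hQ c hc hcQ hcH hc0
  obtain ⟨𝒳, S, f, s₁, s₀, ι, W, hf, h𝒳, hS, hirrS, hsm, hW, hWeil, hread, A₀, ⟨e₀⟩, hA₀dim, hA₀cm, hgen⟩ :=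
    hP A φ P e m hPm hPe he hirr hφ hdim hnr hQ c hc hcQ hcH hc0
  have hxQ : IsRationalClass (complexBetti.map e₀.hom (2 * m) (complexBetti.map (fiberι f s₀) (2 * m) W)) :=
    (isRationalClass_map_iff_of_iso e₀).2 (hW s₀).1
  have hxH : IsOfHodgeType A₀.dim A₀.X (2 * m) m m
      (complexBetti.map e₀.hom (2 * m) (complexBetti.map (fiberι f s₀) (2 * m) W)) := by
    rw [hA₀dim]; exact (isOfHodgeType_map_iff_of_iso e₀).2 (hW s₀).2
  exact ⟨𝒳, S, f, s₁, s₀, ι, W, hf, h𝒳, hS, hirrS, hsm, hW, hWeil, hread, A₀, e₀, hA₀dim, hA₀cm, hgen _ hxQ hxH⟩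

/-- The Weil-divisorial leaf implies gen 1's CM-pointed leaf: drop the last clause.
[cite: Deligne1982HodgeCycles, §5] -/
theorem cmPointedWeilFamiliesCMField_of_weilDivisorialCMPointed
    (hP : WeilDivisorialCMPointedWeilFamiliesCMField) : CMPointedWeilFamiliesCMField := by
  intro A φ P e m hPm hPe he hirr hφ hdim hnr hQ c hc hcQ hcH hc0
  obtain ⟨𝒳, S, f, s₁, s₀, ι, W, hf, h𝒳, hS, hirrS, hsm, hW, hWeil, hread, A₀, e₀, hA₀dim, hA₀cm, -⟩ :=
    hP A φ P e m hPm hPe he hirr hφ hdim hnr hQ c hc hcQ hcH hc0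
  exact ⟨𝒳, S, f, s₁, s₀, ι, W, hf, h𝒳, hS, hirrS, hsm, hW, hWeil, hread, A₀, ⟨e₀⟩, hA₀dim, hA₀cm⟩

/-- **A Weil-divisorial CM-pointed Weil family is an anchored Weil family — no `HC_CM`**:
`WeilDivisorialCMPointedWeilFamiliesCMField → AnchoredWeilFamiliesCMField` (R3anc). The restricted class is divisorial
in the CM chart, hence algebraic (`divisorClassesSpan_le_algebraicClasses_dim`), read back along the chart. Compare gen
1's `anchoredWeilFamiliesCMField_of_HC_CM_of_cmPointed` (binder `hCM`) and gen 2's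
`anchoredWeilFamiliesCMField_of_divisorGeneratedCMPointed` (anchor-good `K`). [cite: vanGeemen1994HodgeAV, §2.4]
[cite: Deligne1982HodgeCycles, §4, proof of Thm. 4.8 (a)–(c)] -/
theorem anchoredWeilFamiliesCMField_of_weilDivisorialCMPointed
    (hP : WeilDivisorialCMPointedWeilFamiliesCMField) : AnchoredWeilFamiliesCMField := by
  intro A φ P e m hPm hPe he hirr hφ hdim hnr hQ c hc hcQ hcH hc0
  obtain ⟨𝒳, S, f, s₁, s₀, ι, W, hf, h𝒳, hS, hirrS, hsm, hW, hWeil, hread, A₀, e₀, hA₀dim, -, hdiv⟩ :=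
    hP A φ P e m hPm hPe he hirr hφ hdim hnr hQ c hc hcQ hcH hc0
  exact ⟨𝒳, S, f, s₁, s₀, ι, W, hf, h𝒳, hS, hirrS, hsm, hW, hWeil, hread,
    (mem_algebraicClasses_map_iff_of_iso e₀).1 (divisorClassesSpan_le_algebraicClasses_dim A₀ m hdiv)⟩

/-! ### §2 The rows with `HC_CM` DELETED, over EVERY CM field -/

/-- **Row R3, no `HC_CM`: `WeilDivisorialCMPointedWeilFamiliesCMField → WeilVariationalHodgeCMField → WeilClassesCMField`**
(tree glue `weilClassesCMField_of_anchored_of_variational`). Gen 1's `HC_WeilClassesCMField_of_HC_CM` with the binder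
`hCM` removed; gen 2's `HC_WeilClassesCMField_of_divisorGeneratedCMPointed` with the anchor leaf weakened to the one
print supplies for every CM field. CONDITIONAL on both named hypotheses (ours, open); ON-PATH lemma of the target:
tree `WeilTypeLadder.weilClassesCMField_of_hodgeConjecture`. [cite: Deligne1982HodgeCycles, §4–5]
[cite: CharlesSchnell2014Notes, Conj. 11.3.1 and Prop. 11.3.11]
[cite: Markman2025SecantRealMultiplication, Cor. 10.2.3 (preprint, unrefereed; strategy only)] -/
theorem HC_WeilClassesCMField_of_weilDivisorialCMPointed
    (hP : WeilDivisorialCMPointedWeilFamiliesCMField) (hV : WeilVariationalHodgeCMField) : WeilClassesCMField :=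
  weilClassesCMField_of_anchored_of_variational (anchoredWeilFamiliesCMField_of_weilDivisorialCMPointed hP) hV

/-- **Row R3-local, no `HC_CM`: Weil-divisorial CM-pointed families + the LOCAL germ at CM fibres
(`LocalWeilVHCAtCMField`) ⟹ R3.** The CM chart is kept in the leaf precisely so that the local hypothesis applies;
algebraicity at `s₀` is `HC_CM`-free (§1); then Baire + Charles–Schnell over the smooth irreducible quasi-projective
base (`mem_algebraicClasses_of_isOpen_subset_algebraicityLocus`). Gen 5's
`HC_WeilClassesCMField_of_divisorGeneratedCMPointed_local` with the anchor leaf weakened.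
[cite: CharlesSchnell2014Notes, Prop. 11.3.11 (proof)] [cite: BuchweitzFlenner2003, Thm. 5.1]
[cite: Deligne1982HodgeCycles, §5] -/
theorem HC_WeilClassesCMField_of_weilDivisorialCMPointed_local
    (hP : WeilDivisorialCMPointedWeilFamiliesCMField) (hL : LocalWeilVHCAtCMField) : WeilClassesCMField := by
  intro A φ P e m hPm hPe he hirr hφ hdim hnr hQ c hc hcQ hcH
  by_cases hc0 : c = 0
  · rw [hc0]; exact Submodule.zero_mem _
  rcases Nat.eq_zero_or_pos m with hm0 | hm
  · subst hm0
    rw [algebraicClasses_zero]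
    exact Submodule.mem_top
  obtain ⟨𝒳, S, f, s₁, s₀, ι, W, hf, h𝒳, hS, hirrS, hsm, hW, hWeil, hread, A₀, e₀, hA₀dim, hA₀cm, hdiv⟩ :=
    hP A φ P e m hPm hPe he hirr hφ hdim hnr hQ c hc hcQ hcH hc0
  haveI := hirrS
  have hs₀ : complexBetti.map (fiberι f s₀) (2 * m) W ∈ algebraicClasses (fiberOver f s₀) m :=
    (mem_algebraicClasses_map_iff_of_iso e₀).1 (divisorClassesSpan_le_algebraicClasses_dim A₀ m hdiv)
  obtain ⟨U, hU, hs₀U, hUalg⟩ :=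
    hL P e m hPm hPe he hirr hnr hQ hm f hf h𝒳 hS hirrS hsm W hW hWeil s₀ ⟨A₀, ⟨e₀⟩, hA₀dim, hA₀cm⟩ hs₀
  have h1 : complexBetti.map (fiberι f s₁) (2 * m) W ∈ algebraicClasses (fiberOver f s₁) m :=
    mem_algebraicClasses_of_isOpen_subset_algebraicityLocus f h𝒳 hS hsm hf W hU ⟨s₀, hs₀U⟩ hUalg s₁
  rw [← hread]
  exact (mem_algebraicClasses_map_iff_of_iso ι).2 h1

/-- **Row R3-germ, no `HC_CM`: Weil-divisorial CM-pointed families + the semiregular Chern lift at CM fibres +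
Buchweitz–Flenner 2003 Thm. 5.1 (refereed named fact, binder) ⟹ R3.** No preprint is an input of this row.
[cite: BuchweitzFlenner2003, §5 Thm. 5.1] [cite: CharlesSchnell2014Notes, Prop. 11.3.11 (proof)] -/
theorem HC_WeilClassesCMField_of_weilDivisorialCMPointed_of_semiregularChernLift (C : ChernCharacterBetti)
    (hP : WeilDivisorialCMPointedWeilFamiliesCMField) (hL : SemiregularChernLiftAtCMField C)
    (hBF : BuchweitzFlenner2003_variationalHodge_ISemiregular) : WeilClassesCMField :=
  HC_WeilClassesCMField_of_weilDivisorialCMPointed_local hP (localWeilVHCAtCMField_of_semiregularChernLift C hBF hL)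

/-- **Row T6-CM (closed form), no `HC_CM`: `(#24) → WeilDivisorialCMPointedWeilFamiliesCMField →
WeilVariationalHodgeCMField → HodgeGeneralWeilTypeCMField`** — the Hodge conjecture for every GENERAL Weil-type
abelian variety with respect to an arbitrary CM field, through gen 5's closed T6-CM row
(`hodgeGeneralWeilTypeCMField_of_weilClassesCMField_closed`; Moonen–Zarhin and descent discharged there). Deligne's
endnote (fact #24) is UNREFEREED ×2 and stays an explicit binder.
[cite: Deligne1982HodgeCycles, §4 (4.4), Prop. 4.4, endnote 16] [cite: MoonenZarhin1998WeilClasses, §1] -/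
theorem HC_GeneralWeilTypeCMField_of_weilDivisorialCMPointed_closed
    (h24 : Deligne1982_hodgeRing_weilTypeCM_of_hodgeGroupSU)
    (hP : WeilDivisorialCMPointedWeilFamiliesCMField) (hV : WeilVariationalHodgeCMField) : HodgeGeneralWeilTypeCMField :=
  hodgeGeneralWeilTypeCMField_of_weilClassesCMField_closed h24 (HC_WeilClassesCMField_of_weilDivisorialCMPointed hP hV)

/-- **Row T6-CM-local (closed form), no `HC_CM`.** [cite: Deligne1982HodgeCycles, §4 (4.4), Prop. 4.4, endnote 16]
[cite: CharlesSchnell2014Notes, Prop. 11.3.11 (proof)] -/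
theorem HC_GeneralWeilTypeCMField_of_weilDivisorialCMPointed_local_closed
    (h24 : Deligne1982_hodgeRing_weilTypeCM_of_hodgeGroupSU)
    (hP : WeilDivisorialCMPointedWeilFamiliesCMField) (hL : LocalWeilVHCAtCMField) : HodgeGeneralWeilTypeCMField :=
  hodgeGeneralWeilTypeCMField_of_weilClassesCMField_closed h24
    (HC_WeilClassesCMField_of_weilDivisorialCMPointed_local hP hL)

/-! ### §3 `HC_CM` is an OUTPUT of the transport line — now with the anchor leaves print supplies for every `K` -/

/-- **`HC_CM` FROM the transport line, every anchor `HC_CM`-free and available in print for every field.** André 1992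
(tree fact `Andre1992_hodgeClasses_cmAbelianVariety_mem_span_pullback_weilClasses`: every Hodge class on a CM abelian
variety is a sum of pull-backs of Weil classes from CM abelian varieties of Weil type) turns R∞ ∧ R3 into `HC_CM`
(tree `rankFourFaces_cmAbelianHodge_of_andre_of_rungs`). Feed it gen 2's `HC_CM`-free R∞ (imaginary quadratic `K`:
every such `K` is anchor-good, `E_K^{2n}`) and THIS file's `HC_CM`-free R3 (Weil-divisorial anchors, every CM field by
Lemma N). Compared with gen 2's `HC_CM_of_andre_of_divisorGeneratedCMPointed_of_variational` the CAVEAT "unless every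
CM field is anchor-good" is GONE: both anchor leaves are now the ones the moduli argument supplies for every field.
What remains conditional is exactly: the two VARIATIONAL leaves (R∞var, R3var — cases of Grothendieck's VHC, open)
and the EXISTENCE of the families as formal objects of the tree (both CM-pointed leaves, open as typed). HONEST: this
is a kernel-checked IMPLICATION, not a proof sketch of `HC_CM`; VHC on Weil families is the whole difficulty.
[cite: Andre1992HodgeCM, Théorème] [cite: Deligne1982HodgeCycles, §4–5] [cite: Gordon1997, §3 Theorem]
[cite: Markman2025SurveySecant, Thm. 1.4 and §12 (preprint / ICM 2026 lecture, unrefereed; strategy only)] -/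
theorem HC_CM_of_andre_of_weilDivisorialCMPointed_of_variational
    (hA : Andre1992_hodgeClasses_cmAbelianVariety_mem_span_pullback_weilClasses)
    (hP₂ : DivisorGeneratedCMPointedWeilFamiliesQuadratic) (hV₂ : WeilVariationalHodgeQuadratic)
    (hP₃ : WeilDivisorialCMPointedWeilFamiliesCMField) (hV₃ : WeilVariationalHodgeCMField) :
    Theses.RankFourFaces.CMAbelianHodge :=
  rankFourFaces_cmAbelianHodge_of_andre_of_rungs hA
    (HC_WeilClassesQuadratic_of_divisorGeneratedCMPointed hP₂ hV₂)
    (HC_WeilClassesCMField_of_weilDivisorialCMPointed hP₃ hV₃)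

/-! ### §4 Audit: position of the Weil-divisorial leaf (kernel-checked conjunction) -/

/-- **Position of Sup_Wdiv**: between gen 2's Sup_div and gen 1's Sup; implies R3anc with no `HC_CM`; with R3var it
gives R3; and R3 is a case of the summit (ON-PATH). Nothing is decided: every arrow into a rung starts at an OPEN leaf.
[cite: Deligne1982HodgeCycles, §4–5] [cite: CharlesSchnell2014Notes, Conj. 11.3.1] -/
theorem weilDivisorialAnchors_position :
    (DivisorGeneratedCMPointedWeilFamiliesCMField → WeilDivisorialCMPointedWeilFamiliesCMField) ∧
    (WeilDivisorialCMPointedWeilFamiliesCMField → CMPointedWeilFamiliesCMField) ∧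
    (WeilDivisorialCMPointedWeilFamiliesCMField → AnchoredWeilFamiliesCMField) ∧
    (WeilDivisorialCMPointedWeilFamiliesCMField → WeilVariationalHodgeCMField → WeilClassesCMField) ∧
    (WeilDivisorialCMPointedWeilFamiliesCMField → LocalWeilVHCAtCMField → WeilClassesCMField) ∧
    (_root_.HodgeConjecture → WeilClassesCMField) :=
  ⟨weilDivisorialCMPointed_of_divisorGeneratedCMPointed, cmPointedWeilFamiliesCMField_of_weilDivisorialCMPointed,
    anchoredWeilFamiliesCMField_of_weilDivisorialCMPointed, HC_WeilClassesCMField_of_weilDivisorialCMPointed,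
    HC_WeilClassesCMField_of_weilDivisorialCMPointed_local, weilClassesCMField_of_hodgeConjecture⟩

end Summit.HodgeConjecture.HodgeConjecture.Ring2Transport

end
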